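import Summits.AtomisticToContinuum.HydrodynamicLimit.Theorems.CorrectorPressureDecay.Negative.FastSectorSandwichCore
import Mathlib.MeasureTheory.Measure.Tilted
import Mathlib.InformationTheory.KullbackLeibler.Basic

/-!
# Gibbs variational principle at the tilt (equality case) — stub `stub_tiltedKL`

Registered stub `stub_tiltedKL` of line `FirstLemma` (idea `kifer-compactification`) of the crux
stmt-AtomisticToContinuum-14135 `AntiMazurCoboundaries.CorrectorPressureDecay`, namespace
`Summit.AtomisticToContinuum.HydrodynamicLimit.Theorems.KiferCompactification`, proved verbatim.

For a probability measure `ν` and a bounded measurable `A : X → ℝ` (`|A| ≤ K`), the exponential tilt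
`ν.tilted A = e^{A} ν / ∫ e^{A} dν` (Mathlib `MeasureTheory.Measure.tilted`) is a probability measure,
`KL(ν.tilted A ‖ ν) ≠ ∞`, and `KL(ν.tilted A ‖ ν) = ∫ A d(ν.tilted A) − log ∫ e^{A} dν`.

The three conjuncts are assembled from already-landed abstract tree theorems (Part A of
`Theorems/CorrectorPressureDecay/Negative/FastSectorSandwichCore.lean`, itself on `Negative/MazurFloor.lean`;
both are pure measure theory on an arbitrary measurable space and are already transitive imports of the line
file): `integrable_exp_of_abs_le` (so Mathlib's `isProbabilityMeasure_tilted` applies),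
`klDiv_tilted_ne_top`, `toReal_klDiv_tilted` (via Mathlib `log_rnDeriv_tilted_left_self`,
`InformationTheory.toReal_klDiv_of_measure_eq`).
-/

noncomputable section

open MeasureTheory ProbabilityTheory Set

namespace Summit.AtomisticToContinuum.HydrodynamicLimit.Theorems.KiferCompactification

open Summit.AtomisticToContinuum.HydrodynamicLimit.Theorems.CorrectorPressureDecayNegative
  (integrable_exp_of_abs_le)
open Summit.AtomisticToContinuum.HydrodynamicLimit.Theorems.CorrectorPressureDecayNegative.FastSectorSandwich
  (klDiv_tilted_ne_top toReal_klDiv_tilted)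

/-- **Gibbs variational principle at the tilt, equality case.** For a probability measure `ν` and a
bounded measurable `A` (`|A| ≤ K`): the tilt `ν.tilted A` is a probability measure,
`KL(ν.tilted A ‖ ν) ≠ ∞`, and `KL(ν.tilted A ‖ ν) = ∫ A d(ν.tilted A) − log ∫ e^{A} dν`.
Registered stub `stub_tiltedKL` of line `FirstLemma` (crux stmt-AtomisticToContinuum-14135). [folklore] -/
theorem stub_tiltedKL {X : Type*} [MeasurableSpace X] (ν : Measure X) [IsProbabilityMeasure ν]
    (A : X → ℝ) (K : ℝ) (hA : Measurable A) (hK : ∀ x, |A x| ≤ K) :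
    IsProbabilityMeasure (ν.tilted A) ∧ InformationTheory.klDiv (ν.tilted A) ν ≠ ⊤ ∧
      (InformationTheory.klDiv (ν.tilted A) ν).toReal =
        (∫ x, A x ∂(ν.tilted A)) - Real.log (∫ x, Real.exp (A x) ∂ν) :=
  ⟨isProbabilityMeasure_tilted (integrable_exp_of_abs_le hA hK), klDiv_tilted_ne_top hA hK,
    toReal_klDiv_tilted hA hK⟩

end Summit.AtomisticToContinuum.HydrodynamicLimit.Theorems.KiferCompactification
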